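import Summits.ResolutionOfSingularities.ResolutionOfSingularities.Theorems.FrobeniusLadderFInjectiveMacaulayficationCIEnginePrime
import Summits.ResolutionOfSingularities.ResolutionOfSingularities.Theorems.FrobeniusLadderFInjectiveMacaulayficationLevelTwoBlockTranslate
import HarnessLib

/-!
# The strict-transform chart IS the naive quotient GLOBALLY when the strict transform is prime: `R[I_A R/x̄^m] ≅ k[Y]/(g)`
# (crux `FInjectiveMacaulayfication` stmt-ResolutionOfSingularities-15315, chain w45a; res-L1-w45a-plan-1 RULING R21.23 (2)(α) «stub-1: supply the GLOBAL chart-model iso lemma — G prime, B₂₇₇ a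
# domain quotient of k[Y]/(G)»; seat res-L1-w45a-stub-1 g12; sequel of ✓ p503677 `CIChartPresentationLocal` (`exists_corestriction`, `span_le_ker_and_sat`) and ✓ p653470 `CIEnginePrime`)

[OURS · L1 W4.5a] Support file (`--supports stmt-ResolutionOfSingularities-15315 --as helper`); def-free; UNCONDITIONAL; no named fact. AI-written (AI review weaker than expert review).

The CI chart engine proves `(g) ⊆ ker φ ⊆ ((g) : Y^∞)` for a surjective corestriction `φ : k[Y] ↠ B = R[I_A R/x̄^m]` of the chart map (one hypersurface `F`, `θ F = Y^d·g`). If `g` is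
PRIME and no variable divides `g`, the saturation is trivial: `Y^e·h ∈ (g)`, `Y^e ∉ (g)` ⇒ `h ∈ (g)`. Hence:
* `span_singleton_eq_of_sat_of_prime` — `(g) ⊆ K`, `K ⊆ ((g) : Y^∞)`, `g` prime, `∀ i, ¬ Y_i ∣ g` ⇒ `K = (g)` (pure algebra, any ideal `K`);
* ★ `ker_eq_span_of_prime` — for the engine's corestriction: `ker φ = (g)`;
* ★★ `nonempty_ringEquiv_quotient_of_prime` — `k[Y]/(g) ≃+* B` (`RingHom.quotientKerEquivOfSurjective`), i.e. the chart `D₊(x̄^m t) = Spec B` of `Bl_{I_A} X` IS `Spec k[Y]/(g) = V(g)`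
  GLOBALLY, not only at localizations (`CIChartPresentationBridge`). Used by row #8 (BED D, storey 2 on the chart `U₂₇₇ ≅ V(G)`, `G` prime ✓ p663116).
[folklore; cite: StacksProject, Tag 0804]
-/

-- single-problem summit: the doubled namespace component is forced
set_option linter.dupNamespace false

noncomputable section

open MvPolynomial

namespace Summit.ResolutionOfSingularities.ResolutionOfSingularities.Theorems.FInjectiveMacaulayfication.CIChartGlobalIso

open Summit.ResolutionOfSingularities.ResolutionOfSingularities.Theorems.FInjectiveMacaulayfication

variable {k : Type} [Field k] {n : ℕ}

/-- **Trivial saturation for a prime not divisible by a variable**: `(g) ⊆ K ⊆ ((g) : Y^∞)`, `g` prime, `Y_i ∤ g` for all `i` ⇒ `K = (g)`. [folklore] -/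
theorem span_singleton_eq_of_sat_of_prime (g : MvPolynomial (Fin n) k) (hg : Prime g) (hX : ∀ i : Fin n, ¬ (X i ∣ g))
    (K : Ideal (MvPolynomial (Fin n) k)) (hle : Ideal.span {g} ≤ K)
    (hsat : ∀ h ∈ K, ∃ e : Fin n →₀ ℕ, monomial e (1 : k) * h ∈ Ideal.span {g}) :
    K = Ideal.span {g} := by
  refine le_antisymm (fun h hh => ?_) hle
  obtain ⟨e, he⟩ := hsat h hh
  rw [Ideal.mem_span_singleton] at he ⊢
  -- `g ∣ Y^e · h`, `g` prime, `g ∤ Y^e` ⇒ `g ∣ h`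
  rcases hg.dvd_or_dvd he with h1 | h2
  · exfalso
    -- `g ∣ Y^e = ∏ Y_i^{e_i}` ⇒ `g ∣ Y_i` for some `i` ⇒ `g` is a unit multiple of `Y_i` ⇒ `Y_i ∣ g`
    rw [monomial_eq, C_1, one_mul, Finsupp.prod] at h1
    obtain ⟨i, -, hi⟩ := (Prime.dvd_finsetProd_iff hg _).mp h1
    have hgi : g ∣ X i := hg.dvd_of_dvd_pow hi
    obtain ⟨u, hu⟩ := hgi
    -- `X i = g * u`: `X i` is prime, so `g` or `u` is a unit multiple…; use irreducibility of `X i`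
    have hirr : Irreducible (X i : MvPolynomial (Fin n) k) := (MvPolynomial.X_prime (i := i)).irreducible
    rcases hirr.isUnit_or_isUnit hu with hgu | huu
    · exact hg.not_unit hgu
    · apply hX i
      obtain ⟨v, hv⟩ := huu
      refine ⟨↑v⁻¹, ?_⟩
      rw [hu, ← hv, mul_assoc, Units.mul_inv, mul_one]
  · exact h2

/-- ★ **The kernel of the chart corestriction IS `(g)`** when `g` is prime and no variable divides it — the sandwich `(g) ⊆ ker φ ⊆ ((g) : Y^∞)` of
`CIChartPresentationLocal.span_le_ker_and_sat_of_isPrime` collapses. One hypersurface (`r = 1`). [folklore] -/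
theorem ker_eq_span_of_prime (V : Matrix (Fin n) (Fin n) ℕ) (hV : IsUnit (V.map (Nat.cast : ℕ → ℤ)).det) (m : Fin n →₀ ℕ) (a : Fin n → (Fin n →₀ ℕ))
    (hgen : ∀ i : Fin n, (Finsupp.equivFunOnFinite.symm (V.mulVec ⇑(a i)) : Fin n →₀ ℕ) = Finsupp.equivFunOnFinite.symm (V.mulVec ⇑m) + Finsupp.single i 1)
    (F g : MvPolynomial (Fin n) k) (d : Fin n →₀ ℕ)
    (hθ : aeval (fun j : Fin n => ∏ l : Fin n, (X l : MvPolynomial (Fin n) k) ^ V l j) F = monomial d (1 : k) * g)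
    (hFprime : (Ideal.span (Set.range (![F] : Fin 1 → MvPolynomial (Fin n) k))).IsPrime)
    (hXne : ∀ j : Fin n, Ideal.Quotient.mk (Ideal.span (Set.range (![F] : Fin 1 → MvPolynomial (Fin n) k))) (X j) ≠ 0)
    (hg : Prime g) (hX : ∀ i : Fin n, ¬ (X i ∣ g))
    {B' : Type} [CommRing B'] (φ : MvPolynomial (Fin n) k →+* B')
    (hker : ∀ h : MvPolynomial (Fin n) k, h ∈ RingHom.ker φ ↔ aeval (fun i : Fin n => algebraMap (MvPolynomial (Fin n) k ⧸ Ideal.span (Set.range (![F] : Fin 1 → MvPolynomial (Fin n) k)))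
          (Localization.Away (Ideal.Quotient.mk (Ideal.span (Set.range (![F] : Fin 1 → MvPolynomial (Fin n) k))) (monomial m (1 : k))))
          (Ideal.Quotient.mk (Ideal.span (Set.range (![F] : Fin 1 → MvPolynomial (Fin n) k))) (monomial (a i) (1 : k))) *
          IsLocalization.Away.invSelf (Ideal.Quotient.mk (Ideal.span (Set.range (![F] : Fin 1 → MvPolynomial (Fin n) k))) (monomial m (1 : k)))) h = 0) :
    RingHom.ker φ = Ideal.span {g} := by
  have hθF : ∀ i : Fin 1, aeval (fun j : Fin n => ∏ l : Fin n, (X l : MvPolynomial (Fin n) k) ^ V l j) ((![F] : Fin 1 → MvPolynomial (Fin n) k) i) =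
      monomial ((fun _ : Fin 1 => d) i) (1 : k) * (![g] : Fin 1 → MvPolynomial (Fin n) k) i := by
    intro i
    fin_cases i
    exact hθ
  have hks := CIChartPresentationLocal.span_le_ker_and_sat_of_isPrime V hV m a hgen (![F] : Fin 1 → MvPolynomial (Fin n) k) (![g]) (fun _ => d) hθF hFprime hXne φ hker
  have hr : Set.range (![g] : Fin 1 → MvPolynomial (Fin n) k) = {g} := LevelTwoBlockTranslate.range_vec_one g
  rw [hr] at hks
  exact span_singleton_eq_of_sat_of_prime g hg hX _ hks.1 hks.2

/-- ★★ **The chart of the strict transform IS `k[Y]/(g)` GLOBALLY**: a surjective corestriction `φ` of the chart map with `ker φ = (g)` gives `k[Y]/(g) ≃+* B`. [folklore] -/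
theorem nonempty_ringEquiv_quotient_of_ker_eq {B' : Type} [CommRing B'] (φ : MvPolynomial (Fin n) k →+* B') (hsurj : Function.Surjective φ)
    (g : MvPolynomial (Fin n) k) (hker : RingHom.ker φ = Ideal.span {g}) :
    Nonempty (MvPolynomial (Fin n) k ⧸ Ideal.span {g} ≃+* B') := by
  refine ⟨(Ideal.quotEquivOfEq hker.symm).trans (RingHom.quotientKerEquivOfSurjective hsurj)⟩

end Summit.ResolutionOfSingularities.ResolutionOfSingularities.Theorems.FInjectiveMacaulayfication.CIChartGlobalIso

end
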